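import Summits.NavierStokesRegularity.NavierStokesRegularity.Theorems.ExtremiserTransienceNearExtremalTransienceExtremiserLiouvilleConstantSpeedSlideTail
import HarnessLib

/-!
# Crux `ExtremiserTransience.NearExtremalTransience` (stmt-NavierStokesRegularity-21883), line `extremiser_liouville`,
# stub K1b — KINEMATICS OF THE SLIDE'S BOUNDARY TERM: `∫g‴V₂² = 2∫g′(∂₂V₂)² + 2∫g′⟪∇_hV₂, ∂₂V_h⟫`

`--supports stmt-NavierStokesRegularity-21883` (helper).  Author: prover seat `ns-el-k1b` (g8).  Record:
`Cruxes/NearExtremalTransience/Lines/extremiser_liouville_k1b_slide.md` (KIN).  Continues `…ConstantSpeedSlideTail`.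

After `…SlideEnstrophyLaw` and `…SlideTail` the only undifferentiated term of the enstrophy variation along the Piola slide is
`−½∫g‴(x₂)(‖V‖² − 2V₂²)`.  For the residue JET the energy-flux invariance (`integral_deriv_axialTest_mul_sq_eq_zero`, p670434)
kills `∫g‴‖V‖²`, leaving `∫g‴V₂²`, and this file moves the two derivatives back onto `V₂ = −‖V‖²/2M`:
* `integral_axialWeight_deriv_mul_eq` : the bilinear axial rule `∫w′(x₂)·p = −∫w(x₂)·∂₂p`;
* `integral_axialWeight_inner_grad_fderiv_eq` : the horizontal step `∫w(x₂)⟪∇_hV₂, ∂₂V_h⟫ = ∫w(x₂)·V₂·∂₂²V₂` for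
  divergence-free `V ∈ C²` (`div ∂₂V = 0`, `…SlideGenerator.divergence_fderiv_apply_eq_zero`);
* `integral_thirdDeriv_weight_mul_sq_eq` : **`∫g‴(x₂)V₂² = 2∫g′(x₂)(∂₂V₂)² + 2∫g′(x₂)⟪∇_hV₂,∂₂V_h⟫`** — both right-hand terms are
  `γ = g′`-weighted DERIVATIVE densities, the first with the coercive sign, the second `V₂`-small
  (`|∇_hV₂| ≤ (‖V‖/M)|∇_hV|` on the residue), as claimed in the record.
Integrability of the weighted densities is first assumed, then discharged (§4) from `DV, ∂₂(∂₂V) ∈ L²` and slab integrability;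
the JET assembly (`slideEnstrophyLaw_jet`: energy-flux invariance p670434 + `…SlideEnstrophyLaw` + these kinematics ⇒ `a₁(φ_g)` is a
pure `g′`-weighted DERIVATIVE form, the W′-line of the record's (INEQ)) is the next file `…SlideEnstrophyLawJet`.

WHAT THIS IS NOT: K1b is NOT proved; nothing here proves NS regularity. [folklore]
-/

noncomputable section

open Set Filter Topology MeasureTheory Metric Function InnerProductSpace
open scoped ENNReal NNReal Topology InnerProductSpace RealInnerProductSpace ContDiff
open Literature.Analysis.FluidPDE Literature.Analysis

namespace Summit.NavierStokesRegularity.NavierStokesRegularity.Theorems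

-- the problem directory repeats the summit name (`NavierStokesRegularity/NavierStokesRegularity`)
set_option linter.dupNamespace false

namespace ExtremiserLiouville

open DepletionLadder.KStar

variable {V : EuclideanSpace ℝ (Fin 3) → EuclideanSpace ℝ (Fin 3)} {p : EuclideanSpace ℝ (Fin 3) → ℝ} {w g : ℝ → ℝ}

/-! ## 1. The bilinear axial rule -/

/-- **`∫ w′(x₂)·p = −∫ w(x₂)·∂₂p`** for `p ∈ C¹(ℝ³)`, `w ∈ C¹(ℝ)` with `w p`, `w′p`, `w ∂₂p` integrable (divergence theorem for
the field `(w(x₂)p)·e₂`). [folklore] -/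
theorem integral_axialWeight_deriv_mul_eq (hp : ContDiff ℝ 1 p) (hw : ContDiff ℝ 1 w)
    (i0 : Integrable (fun x => w (x 2) * p x) volume)
    (i1 : Integrable (fun x => deriv w (x 2) * p x) volume)
    (i2 : Integrable (fun x => w (x 2) * fderiv ℝ p x (EuclideanSpace.single (2 : Fin 3) (1 : ℝ))) volume) :
    (∫ x, deriv w (x 2) * p x) = -∫ x, w (x 2) * fderiv ℝ p x (EuclideanSpace.single (2 : Fin 3) (1 : ℝ)) := by
  set e₂ : EuclideanSpace ℝ (Fin 3) := EuclideanSpace.single (2 : Fin 3) (1 : ℝ) with he₂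
  have hpd : Differentiable ℝ p := hp.differentiable one_ne_zero
  have hwd : Differentiable ℝ w := hw.differentiable one_ne_zero
  set a : EuclideanSpace ℝ (Fin 3) → ℝ := fun y => w (y 2) with ha
  have haD : ∀ y, HasFDerivAt a (deriv w (y 2) •
      (EuclideanSpace.proj (2 : Fin 3) : EuclideanSpace ℝ (Fin 3) →L[ℝ] ℝ)) y := fun y => hasFDerivAt_comp_coord hwd 2 y
  have ha1 : ContDiff ℝ 1 a := by
    have : a = fun y => w ((EuclideanSpace.proj (2 : Fin 3) : EuclideanSpace ℝ (Fin 3) →L[ℝ] ℝ) y) := rfl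
    rw [this]; exact hw.comp (EuclideanSpace.proj (2 : Fin 3) : EuclideanSpace ℝ (Fin 3) →L[ℝ] ℝ).contDiff
  have hq1 : ContDiff ℝ 1 fun y => a y * p y := ha1.mul hp
  have hY1 : ContDiff ℝ 1 fun y => (a y * p y) • e₂ := hq1.smul contDiff_const
  have iY : Integrable (fun y => (a y * p y) • e₂) volume := i0.smul_const e₂
  have hdivY : ∀ y, VectorCalculus.divergence (fun z => (a z * p z) • e₂) y =
      deriv w (y 2) * p y + w (y 2) * fderiv ℝ p y e₂ := by
    intro y
    rw [Literature.Analysis.FluidPDE.divergence_smul_apply ((hq1.differentiable one_ne_zero) y) (differentiableAt_const e₂)]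
    have hdivconst : VectorCalculus.divergence (fun _ : EuclideanSpace ℝ (Fin 3) => e₂) y = 0 := by
      rw [divergence_eq_sum_three]; simp
    rw [hdivconst, mul_zero, zero_add, real_inner_comm, gradient, InnerProductSpace.toDual_symm_apply]
    have hm : HasFDerivAt (fun z => a z * p z) (a y • fderiv ℝ p y +
        p y • (deriv w (y 2) • (EuclideanSpace.proj (2 : Fin 3) : EuclideanSpace ℝ (Fin 3) →L[ℝ] ℝ))) y :=
      (haD y).mul (hpd y).hasFDerivAt
    rw [hm.fderiv]
    show a y * fderiv ℝ p y e₂ + p y * (deriv w (y 2) * e₂ 2) = _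
    have e2 : e₂ 2 = 1 := by rw [he₂]; simp
    rw [e2, mul_one]
    simp only [ha]
    ring
  have idiv : Integrable (fun y => VectorCalculus.divergence (fun z => (a z * p z) • e₂) y) volume := by
    have e : (fun y => VectorCalculus.divergence (fun z => (a z * p z) • e₂) y) =
        fun y => deriv w (y 2) * p y + w (y 2) * fderiv ℝ p y e₂ := funext hdivY
    rw [e]; exact i1.add i2
  have h0 := integral_divergence_eq_zero_of_integrable hY1 iY idiv
  simp_rw [hdivY] at h0
  rw [integral_add i1 i2] at h0
  linarith

/-! ## 2. The horizontal step -/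

/-- **`∫w(x₂)⟪∇_hV₂, ∂₂V_h⟫ = ∫w(x₂)·V₂·∂₂²V₂`** for divergence-free `V ∈ C²`: the horizontal rule with the horizontal field
`A = ∂₂V − (∂₂V₂)e₂` (`div A = div ∂₂V − ∂₂²V₂ = −∂₂²V₂`) and `f = V₂`; in coordinates
`⟪∇_hV₂,∂₂V_h⟫ = (DVe₀)₂(DVe₂)₀ + (DVe₁)₂(DVe₂)₁`, `∂₂²V₂ = (D(∂₂V)e₂)₂`. [folklore] -/
theorem integral_axialWeight_inner_grad_fderiv_eq (hV : ContDiff ℝ 2 V) (hdiv : VectorCalculus.IsDivFree V)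
    (hw : ContDiff ℝ 1 w)
    (i0 : Integrable (fun x => (w (x 2) * V x 2) •
      (fderiv ℝ V x (EuclideanSpace.single (2 : Fin 3) (1 : ℝ)) -
        (fderiv ℝ V x (EuclideanSpace.single (2 : Fin 3) (1 : ℝ)) 2) • EuclideanSpace.single (2 : Fin 3) (1 : ℝ))) volume)
    (i1 : Integrable (fun x => w (x 2) *
      (fderiv ℝ V x (EuclideanSpace.single 0 1) 2 * fderiv ℝ V x (EuclideanSpace.single 2 1) 0 +
        fderiv ℝ V x (EuclideanSpace.single 1 1) 2 * fderiv ℝ V x (EuclideanSpace.single 2 1) 1)) volume)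
    (i2 : Integrable (fun x => w (x 2) * V x 2 *
      fderiv ℝ (fun y => fderiv ℝ V y (EuclideanSpace.single (2 : Fin 3) (1 : ℝ))) x
        (EuclideanSpace.single (2 : Fin 3) (1 : ℝ)) 2) volume) :
    (∫ x, w (x 2) *
        (fderiv ℝ V x (EuclideanSpace.single 0 1) 2 * fderiv ℝ V x (EuclideanSpace.single 2 1) 0 +
          fderiv ℝ V x (EuclideanSpace.single 1 1) 2 * fderiv ℝ V x (EuclideanSpace.single 2 1) 1)) =
      ∫ x, w (x 2) * V x 2 *
        fderiv ℝ (fun y => fderiv ℝ V y (EuclideanSpace.single (2 : Fin 3) (1 : ℝ))) x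
          (EuclideanSpace.single (2 : Fin 3) (1 : ℝ)) 2 := by
  set e₂ : EuclideanSpace ℝ (Fin 3) := EuclideanSpace.single (2 : Fin 3) (1 : ℝ) with he₂
  have hVd : Differentiable ℝ V := hV.differentiable two_ne_zero
  -- the pieces
  set P : EuclideanSpace ℝ (Fin 3) → EuclideanSpace ℝ (Fin 3) := fun y => fderiv ℝ V y e₂ with hP
  have hP1 : ContDiff ℝ 1 P := contDiff_fderiv_apply_const_succ (n := 1) (by exact_mod_cast hV) e₂
  have hPd : Differentiable ℝ P := hP1.differentiable one_ne_zero
  have hP2c : ContDiff ℝ 1 fun y => P y 2 := contDiff_apply_coord_vec3 hP1 2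
  set A : EuclideanSpace ℝ (Fin 3) → EuclideanSpace ℝ (Fin 3) := fun y => P y - (P y 2) • e₂ with hA
  have hA1 : ContDiff ℝ 1 A := hP1.sub (hP2c.smul contDiff_const)
  have hA2 : ∀ x, A x 2 = 0 := fun x => by
    show (P x - (P x 2) • e₂) 2 = 0
    rw [he₂]; simp
  have hV1 : ContDiff ℝ 1 V := hV.of_le (by norm_num)
  have hf : ContDiff ℝ 1 fun y => V y 2 := contDiff_apply_coord_vec3 hV1 2
  have hV2D : ∀ y, HasFDerivAt (fun z => V z 2)
      ((EuclideanSpace.proj (2 : Fin 3) : EuclideanSpace ℝ (Fin 3) →L[ℝ] ℝ).comp (fderiv ℝ V y)) y :=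
    fun y => (EuclideanSpace.proj (2 : Fin 3) : EuclideanSpace ℝ (Fin 3) →L[ℝ] ℝ).hasFDerivAt.comp y (hVd y).hasFDerivAt
  have hP2D : ∀ y, HasFDerivAt (fun z => P z 2)
      ((EuclideanSpace.proj (2 : Fin 3) : EuclideanSpace ℝ (Fin 3) →L[ℝ] ℝ).comp (fderiv ℝ P y)) y :=
    fun y => (EuclideanSpace.proj (2 : Fin 3) : EuclideanSpace ℝ (Fin 3) →L[ℝ] ℝ).hasFDerivAt.comp y (hPd y).hasFDerivAt
  -- `Df(A) = ⟪∇_hV₂, ∂₂V_h⟫`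
  have hDf : ∀ x, fderiv ℝ (fun z => V z 2) x (A x) =
      fderiv ℝ V x (EuclideanSpace.single 0 1) 2 * fderiv ℝ V x (EuclideanSpace.single 2 1) 0 +
        fderiv ℝ V x (EuclideanSpace.single 1 1) 2 * fderiv ℝ V x (EuclideanSpace.single 2 1) 1 := by
    intro x
    rw [(hV2D x).fderiv]
    show (fderiv ℝ V x (A x)) 2 = _
    have hdec : A x = (P x 0) • EuclideanSpace.single (0 : Fin 3) (1 : ℝ) + (P x 1) • EuclideanSpace.single (1 : Fin 3) (1 : ℝ) := by
      ext i; fin_cases i <;> simp [hA, he₂]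
    rw [hdec, map_add, map_smul, map_smul, PiLp.add_apply, PiLp.smul_apply, PiLp.smul_apply, smul_eq_mul, smul_eq_mul]
    simp only [hP, he₂]
    ring
  -- `div A = −∂₂²V₂`
  have hdivA : ∀ x, VectorCalculus.divergence A x = -(fderiv ℝ P x e₂ 2) := by
    intro x
    have hsplit : A = fun y => P y + (-1 : ℝ) • ((P y 2) • e₂) := by
      funext y; simp only [hA, neg_one_smul]; abel
    have hd2 : Differentiable ℝ fun y => (P y 2) • e₂ := fun y => ((hP2D y).smul_const e₂).differentiableAt
    rw [hsplit, divergence_add_smul hPd hd2, divergence_fderiv_apply_eq_zero hV hdiv x, zero_add,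
      Literature.Analysis.FluidPDE.divergence_smul_apply (hP2D x).differentiableAt (differentiableAt_const e₂)]
    have hdivconst : VectorCalculus.divergence (fun _ : EuclideanSpace ℝ (Fin 3) => e₂) x = 0 := by
      rw [divergence_eq_sum_three]; simp
    rw [hdivconst, mul_zero, zero_add, real_inner_comm, gradient, InnerProductSpace.toDual_symm_apply, (hP2D x).fderiv]
    show -1 * (fderiv ℝ P x e₂ 2) = _
    ring
  have i1' : Integrable (fun x => w (x 2) * fderiv ℝ (fun z => V z 2) x (A x)) volume := by
    have e : (fun x => w (x 2) * fderiv ℝ (fun z => V z 2) x (A x)) = fun x => w (x 2) *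
        (fderiv ℝ V x (EuclideanSpace.single 0 1) 2 * fderiv ℝ V x (EuclideanSpace.single 2 1) 0 +
          fderiv ℝ V x (EuclideanSpace.single 1 1) 2 * fderiv ℝ V x (EuclideanSpace.single 2 1) 1) := by
      funext x; rw [hDf]
    rw [e]; exact i1
  have i2' : Integrable (fun x => w (x 2) * V x 2 * VectorCalculus.divergence A x) volume := by
    have e : (fun x => w (x 2) * V x 2 * VectorCalculus.divergence A x) =
        fun x => (-1) * (w (x 2) * V x 2 * fderiv ℝ P x e₂ 2) := by
      funext x; rw [hdivA]; ring
    rw [e]; exact i2.const_mul (-1)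
  have hB := integral_axialWeight_fderiv_apply_horizontal_eq hA1 hA2 hf hw i0 i1' i2'
  simp_rw [hDf, hdivA] at hB
  rw [hB, ← integral_neg]
  refine integral_congr_ae (Eventually.of_forall fun x => ?_)
  ring

/-! ## 3. The conversion `∫g‴V₂² = 2∫g′(∂₂V₂)² + 2∫g′⟪∇_hV₂,∂₂V_h⟫` -/

/-- **Kinematics of the boundary term.**  For divergence-free `V ∈ C²` and `g ∈ C³` (weights `g′, g″`), with the weighted
densities integrable:
`∫g‴(x₂)V₂² = 2∫g′(x₂)(∂₂V₂)² + 2∫g′(x₂)((DVe₀)₂(DVe₂)₀ + (DVe₁)₂(DVe₂)₁)`. [folklore] -/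
theorem integral_thirdDeriv_weight_mul_sq_eq (hV : ContDiff ℝ 2 V) (hdiv : VectorCalculus.IsDivFree V) (hg : ContDiff ℝ 3 g)
    -- first axial step (`w = g″`, `p = V₂²`)
    (j0 : Integrable (fun x => deriv (deriv g) (x 2) * (V x 2) ^ 2) volume)
    (j1 : Integrable (fun x => deriv (deriv (deriv g)) (x 2) * (V x 2) ^ 2) volume)
    (j2 : Integrable (fun x => deriv (deriv g) (x 2) *
      (V x 2 * fderiv ℝ V x (EuclideanSpace.single (2 : Fin 3) (1 : ℝ)) 2)) volume)
    -- second axial step (`w = g′`, `p = V₂∂₂V₂`)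
    (k0 : Integrable (fun x => deriv g (x 2) *
      (V x 2 * fderiv ℝ V x (EuclideanSpace.single (2 : Fin 3) (1 : ℝ)) 2)) volume)
    (k2a : Integrable (fun x => deriv g (x 2) * (fderiv ℝ V x (EuclideanSpace.single (2 : Fin 3) (1 : ℝ)) 2) ^ 2) volume)
    (k2b : Integrable (fun x => deriv g (x 2) * V x 2 *
      fderiv ℝ (fun y => fderiv ℝ V y (EuclideanSpace.single (2 : Fin 3) (1 : ℝ))) x
        (EuclideanSpace.single (2 : Fin 3) (1 : ℝ)) 2) volume)
    -- horizontal step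
    (l0 : Integrable (fun x => (deriv g (x 2) * V x 2) •
      (fderiv ℝ V x (EuclideanSpace.single (2 : Fin 3) (1 : ℝ)) -
        (fderiv ℝ V x (EuclideanSpace.single (2 : Fin 3) (1 : ℝ)) 2) • EuclideanSpace.single (2 : Fin 3) (1 : ℝ))) volume)
    (l1 : Integrable (fun x => deriv g (x 2) *
      (fderiv ℝ V x (EuclideanSpace.single 0 1) 2 * fderiv ℝ V x (EuclideanSpace.single 2 1) 0 +
        fderiv ℝ V x (EuclideanSpace.single 1 1) 2 * fderiv ℝ V x (EuclideanSpace.single 2 1) 1)) volume) :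
    (∫ x, deriv (deriv (deriv g)) (x 2) * (V x 2) ^ 2) =
      2 * (∫ x, deriv g (x 2) * (fderiv ℝ V x (EuclideanSpace.single (2 : Fin 3) (1 : ℝ)) 2) ^ 2) +
        2 * ∫ x, deriv g (x 2) *
          (fderiv ℝ V x (EuclideanSpace.single 0 1) 2 * fderiv ℝ V x (EuclideanSpace.single 2 1) 0 +
            fderiv ℝ V x (EuclideanSpace.single 1 1) 2 * fderiv ℝ V x (EuclideanSpace.single 2 1) 1) := by
  set e₂ : EuclideanSpace ℝ (Fin 3) := EuclideanSpace.single (2 : Fin 3) (1 : ℝ) with he₂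
  have hVd : Differentiable ℝ V := hV.differentiable two_ne_zero
  have hV1 : ContDiff ℝ 1 V := hV.of_le (by norm_num)
  have hg2 : ContDiff ℝ 2 (deriv g) := by
    have h3 : ContDiff ℝ (2 + 1) g := by rw [show ((2 : WithTop ℕ∞) + 1) = 3 by norm_num]; exact hg
    exact h3.deriv'
  have hg1 : ContDiff ℝ 1 (deriv (deriv g)) := by
    have h2 : ContDiff ℝ (1 + 1) (deriv g) := by rw [show ((1 : WithTop ℕ∞) + 1) = 2 by norm_num]; exact hg2
    exact h2.deriv'
  have hg'1 : ContDiff ℝ 1 (deriv g) := hg2.of_le (by norm_num)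
  -- `p₁ = V₂²`, `∂₂p₁ = 2V₂∂₂V₂`
  have hV2c : ContDiff ℝ 1 fun y => V y 2 := contDiff_apply_coord_vec3 hV1 2
  have hV2D : ∀ y, HasFDerivAt (fun z => V z 2)
      ((EuclideanSpace.proj (2 : Fin 3) : EuclideanSpace ℝ (Fin 3) →L[ℝ] ℝ).comp (fderiv ℝ V y)) y :=
    fun y => (EuclideanSpace.proj (2 : Fin 3) : EuclideanSpace ℝ (Fin 3) →L[ℝ] ℝ).hasFDerivAt.comp y (hVd y).hasFDerivAt
  have hp1 : ContDiff ℝ 1 fun y => V y 2 * V y 2 := hV2c.mul hV2c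
  have hDp1 : ∀ x, fderiv ℝ (fun y => V y 2 * V y 2) x e₂ = 2 * (V x 2 * fderiv ℝ V x e₂ 2) := by
    intro x
    have h : HasFDerivAt (fun y => V y 2 * V y 2)
        (V x 2 • ((EuclideanSpace.proj (2 : Fin 3) : EuclideanSpace ℝ (Fin 3) →L[ℝ] ℝ).comp (fderiv ℝ V x)) +
          V x 2 • ((EuclideanSpace.proj (2 : Fin 3) : EuclideanSpace ℝ (Fin 3) →L[ℝ] ℝ).comp (fderiv ℝ V x))) x :=
      (hV2D x).mul (hV2D x)
    rw [h.fderiv]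
    show V x 2 * (fderiv ℝ V x e₂) 2 + V x 2 * (fderiv ℝ V x e₂) 2 = _
    ring
  have esq : ∀ (u : ℝ → ℝ), (fun x : EuclideanSpace ℝ (Fin 3) => u (x 2) * (V x 2) ^ 2) =
      fun x => u (x 2) * (V x 2 * V x 2) := fun u => by funext x; ring
  have j0' : Integrable (fun x => deriv (deriv g) (x 2) * (V x 2 * V x 2)) volume := by rw [← esq]; exact j0
  have j1' : Integrable (fun x => deriv (deriv (deriv g)) (x 2) * (V x 2 * V x 2)) volume := by rw [← esq]; exact j1
  have j2' : Integrable (fun x => deriv (deriv g) (x 2) * fderiv ℝ (fun y => V y 2 * V y 2) x e₂) volume := by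
    have e : (fun x => deriv (deriv g) (x 2) * fderiv ℝ (fun y => V y 2 * V y 2) x e₂) =
        fun x => 2 * (deriv (deriv g) (x 2) * (V x 2 * fderiv ℝ V x e₂ 2)) := by
      funext x; rw [hDp1]; ring
    rw [e]; exact j2.const_mul 2
  have step1 := integral_axialWeight_deriv_mul_eq hp1 hg1 j0' j1' j2'
  rw [← he₂] at step1
  rw [esq, step1]
  -- `p₂ = V₂∂₂V₂`, `∂₂p₂ = (∂₂V₂)² + V₂∂₂²V₂`  (with `P = ∂₂V = fun y => fderiv ℝ V y e₂`)
  have hP1 : ContDiff ℝ 1 (fun y => fderiv ℝ V y e₂) := contDiff_fderiv_apply_const_succ (n := 1) (by exact_mod_cast hV) e₂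
  have hPd : Differentiable ℝ (fun y => fderiv ℝ V y e₂) := hP1.differentiable one_ne_zero
  have hP2c : ContDiff ℝ 1 fun y => fderiv ℝ V y e₂ 2 := contDiff_apply_coord_vec3 hP1 2
  have hP2D : ∀ y, HasFDerivAt (fun z => fderiv ℝ V z e₂ 2)
      ((EuclideanSpace.proj (2 : Fin 3) : EuclideanSpace ℝ (Fin 3) →L[ℝ] ℝ).comp (fderiv ℝ (fun y => fderiv ℝ V y e₂) y)) y :=
    fun y => (EuclideanSpace.proj (2 : Fin 3) : EuclideanSpace ℝ (Fin 3) →L[ℝ] ℝ).hasFDerivAt.comp y (hPd y).hasFDerivAt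
  have hp2 : ContDiff ℝ 1 fun y => V y 2 * fderiv ℝ V y e₂ 2 := hV2c.mul hP2c
  have hDp2 : ∀ x, fderiv ℝ (fun y => V y 2 * fderiv ℝ V y e₂ 2) x e₂ =
      (fderiv ℝ V x e₂ 2) ^ 2 + V x 2 * fderiv ℝ (fun y => fderiv ℝ V y e₂) x e₂ 2 := by
    intro x
    have h : HasFDerivAt (fun y => V y 2 * fderiv ℝ V y e₂ 2)
        (V x 2 • ((EuclideanSpace.proj (2 : Fin 3) : EuclideanSpace ℝ (Fin 3) →L[ℝ] ℝ).comp (fderiv ℝ (fun y => fderiv ℝ V y e₂) x)) +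
          fderiv ℝ V x e₂ 2 • ((EuclideanSpace.proj (2 : Fin 3) : EuclideanSpace ℝ (Fin 3) →L[ℝ] ℝ).comp (fderiv ℝ V x))) x :=
      (hV2D x).mul (hP2D x)
    rw [h.fderiv]
    show V x 2 * (fderiv ℝ (fun y => fderiv ℝ V y e₂) x e₂) 2 + fderiv ℝ V x e₂ 2 * (fderiv ℝ V x e₂) 2 = _
    ring
  have k1 : Integrable (fun x => deriv (deriv g) (x 2) * (V x 2 * fderiv ℝ V x e₂ 2)) volume := j2
  have k2 : Integrable (fun x => deriv g (x 2) * fderiv ℝ (fun y => V y 2 * fderiv ℝ V y e₂ 2) x e₂) volume := by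
    have e : (fun x => deriv g (x 2) * fderiv ℝ (fun y => V y 2 * fderiv ℝ V y e₂ 2) x e₂) =
        fun x => deriv g (x 2) * (fderiv ℝ V x e₂ 2) ^ 2 +
          deriv g (x 2) * V x 2 * fderiv ℝ (fun y => fderiv ℝ V y e₂) x e₂ 2 := by
      funext x; rw [hDp2]; ring
    rw [e]; exact k2a.add k2b
  have step2 := integral_axialWeight_deriv_mul_eq hp2 hg'1 k0 k1 k2
  rw [← he₂] at step2
  -- horizontal step
  have step3 := integral_axialWeight_inner_grad_fderiv_eq hV hdiv hg'1 l0 l1 k2b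
  rw [← he₂] at step3
  -- assemble
  have e1 : (∫ x, deriv (deriv g) (x 2) * fderiv ℝ (fun y => V y 2 * V y 2) x e₂) =
      2 * ∫ x, deriv (deriv g) (x 2) * (V x 2 * fderiv ℝ V x e₂ 2) := by
    rw [← integral_const_mul]
    refine integral_congr_ae (Eventually.of_forall fun x => ?_)
    dsimp only
    rw [hDp1]; ring
  have e2 : (∫ x, deriv g (x 2) * fderiv ℝ (fun y => V y 2 * fderiv ℝ V y e₂ 2) x e₂) =
      (∫ x, deriv g (x 2) * (fderiv ℝ V x e₂ 2) ^ 2) +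
        ∫ x, deriv g (x 2) * V x 2 * fderiv ℝ (fun y => fderiv ℝ V y e₂) x e₂ 2 := by
    rw [← integral_add k2a k2b]
    refine integral_congr_ae (Eventually.of_forall fun x => ?_)
    dsimp only
    rw [hDp2]; ring
  rw [e1, step2, e2, ← step3]
  ring

end ExtremiserLiouville

end Summit.NavierStokesRegularity.NavierStokesRegularity.Theorems

end
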